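import Literature.MathematicalPhysics.KineticTheory.LangevinChainConfined
import Literature.MathematicalPhysics.KineticTheory.LangevinChainHormander
import Literature.MathematicalPhysics.KineticTheory.ConfinedBackwardEquation
import HarnessLib

/-!
# The time-reversed Langevin chain and the duality of its transition kernels

Topic `Literature/MathematicalPhysics/KineticTheory`. For an oscillator chain `P` with confining
potentials (`OscillatorChain.IsConfining`, `LangevinChainConfined.lean`) the Langevin drift
`Y(q, p) = (p, -∇Φ(q) - γ 1_B p)` (CEHR 2018 eq. (2.2)) has CONSTANT divergence `div Y = -2γ`
(`OscillatorChain.fieldDiv_drift`, `N ≥ 1`), and its reversal `-Y` (momenta reversed, anti-friction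
`+γ 1_B p`) is again a regular confined drift for the SAME energy `H` (the lower energy balance of
`Y` is the upper one of `-Y` and vice versa). Hence the model-free time-reversal theory
(`ConfinedDuality.lean`, `ConfinedBackwardEquation.lean`) applies to the transition kernels
`OscillatorChain.langevinKernel` — the twin, for the Langevin baths, of
`ReyBelletThomas2002Reversal.lean`:

* `OscillatorChain.IsConfining.reversedDrift` — `-Y` as a `RegularConfinedDrift`;
  `OscillatorChain.langevinRevKernel` — the transition kernels `P̂_t` of the reversed equation
  `dz = -Y(z) dt + v_L dB^L + v_R dB^R` (Markov, Feller);
* `OscillatorChain.trace_fderiv_drift` — `tr DY ≡ -2γ`;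
* `OscillatorChain.IsConfining.compProd_langevinKernel_eq` — **duality**
  `dx P_t(x, dy) = e^{2γt} dy P̂_t(y, dx)`, with the Lebesgue-integral and Bochner forms and
  `∫ P̂_t(y, A) dy = e^{-2γt}|A|`;
* `OscillatorChain.IsConfining.langevin_backwardEquation` — **the Kolmogorov backward equation**
  for the law `dt dx P_t(x, dy)` tested against `Θ ∈ C_c^∞((0,∞) × Ω × Ω)`:
  `∫₀^∞ ∫dx ∫P_t(x,dy) (∂_tΘ + L̂_xΘ + 2γΘ)(t,x,y) dt = 0`, `L̂` the generator of the reversed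
  equation acting on `x`, so that `Lᵀ = L̂ + 2γ` is the formal transpose of `L`.

Confining potentials which are moreover smooth (for the divergence), `N ≥ 1`.

## References

* N. Cuneo, J.-P. Eckmann, M. Hairer, L. Rey-Bellet, EJP 23 (2018) no. 55, eq. (2.2), §3.1
  ("`L*` is the formal adjoint of the generator").
* U. G. Haussmann, É. Pardoux, *Time reversal of diffusions*, Ann. Probab. 14 (1986) 1188–1205.
-/

noncomputable section

open MeasureTheory ProbabilityTheory Filter Topology Set Function
open scoped NNReal ENNReal ContDiff

namespace Literature.MathematicalPhysics.KineticTheory.HeatConduction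

open Literature.Probability.Process Literature.MathematicalPhysics.KineticTheory
  Literature.Analysis.Distribution

variable {N : ℕ}

namespace OscillatorChain

variable (P : OscillatorChain)

/-! ### The divergence of the drift as a trace -/

/-- `tr DY(y) = -2γ` for every `y` (`N ≥ 1`; the divergence of the Langevin drift is the constant
friction trace, one `-γ` per bath). [folklore] -/
theorem trace_fderiv_drift (hU : ContDiff ℝ ∞ P.U) (hV : ContDiff ℝ ∞ P.V) (hN : 0 < N)
    (y : PhaseSpace N) :
    LinearMap.trace ℝ (PhaseSpace N) (fderiv ℝ (P.drift N) y : PhaseSpace N →ₗ[ℝ] PhaseSpace N) =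
      -(2 * P.γ) :=
  P.fieldDiv_drift hU hV hN y

/-! ### The reversed drift is a regular confined drift -/

namespace IsConfining

variable {P}

/-- **The reversed Langevin drift `-Y` is a regular confined drift** for the same energy `H`,
constant, radius and noise subspace as `IsConfining.confinedDrift`: the upper energy balance of
`-Y` is the lower one of `Y` (the anti-friction `+γ∑_B p_b²` is at most `4γ(H + 1)`) and vice
versa. [folklore] -/
def reversedDrift (hP : P.IsConfining) (N : ℕ) : RegularConfinedDrift (fun y => -P.drift N y) :=
  let D := hP.confinedDrift N
  { V := D.V
    c := D.c
    K := D.K'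
    ρ := D.ρ
    noise := D.noise
    contDiff_drift := D.contDiff_drift.neg
    differentiable_energy := D.differentiable_energy
    energy_nonneg := D.energy_nonneg
    rate_nonneg := D.rate'_nonneg
    fderiv_energy_le := fun M y e he heM => by
      rw [map_neg]
      have h := D.fderiv_energy_ge M y e he heM
      linarith
    norm_le_radius := D.norm_le_radius
    radius_mono := D.radius_mono
    K' := D.K
    Kshift := D.Kshift
    rate_mono := D.rate'_mono
    rate'_nonneg := D.rate_nonneg
    rate'_mono := D.rate_mono
    Kshift_nonneg := D.Kshift_nonneg
    fderiv_energy_ge := fun M y e he heM => by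
      rw [map_neg]
      have h := D.fderiv_energy_le M y e he heM
      linarith
    energy_shift_le := D.energy_shift_le }

/-- The noise subspace of the reversed drift is the momentum subspace. [folklore] -/
@[simp] theorem reversedDrift_noise (hP : P.IsConfining) (N : ℕ) :
    (hP.reversedDrift N).noise = momentumSubspace N := rfl

/-- The energy of the reversed drift is `H`. [folklore] -/
@[simp] theorem reversedDrift_V (hP : P.IsConfining) (N : ℕ) :
    (hP.reversedDrift N).V = P.hamiltonian N := rfl

/-- The bath directions lie in the noise subspace of the reversed drift. [folklore] -/
theorem bathVec_mem_reversedDrift_noise (hP : P.IsConfining) (N k : ℕ) (c : ℝ) :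
    bathVec N k c ∈ (hP.reversedDrift N).noise :=
  bathVec_mem_momentumSubspace N k c

/-- `v_L` lies in the noise subspace. [folklore] -/
theorem bathVecL_mem_noise (hP : P.IsConfining) (N : ℕ) (T_L : ℝ) :
    P.bathVecL N T_L ∈ (hP.confinedDrift N).noise := hP.bathVec_mem_noise N _ _

/-- `v_R` lies in the noise subspace. [folklore] -/
theorem bathVecR_mem_noise (hP : P.IsConfining) (N : ℕ) (T_R : ℝ) :
    P.bathVecR N T_R ∈ (hP.confinedDrift N).noise := hP.bathVec_mem_noise N _ _

/-- `v_L` lies in the noise subspace of the reversed drift. [folklore] -/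
theorem bathVecL_mem_reversedDrift_noise (hP : P.IsConfining) (N : ℕ) (T_L : ℝ) :
    P.bathVecL N T_L ∈ (hP.reversedDrift N).noise := hP.bathVec_mem_reversedDrift_noise N _ _

/-- `v_R` lies in the noise subspace of the reversed drift. [folklore] -/
theorem bathVecR_mem_reversedDrift_noise (hP : P.IsConfining) (N : ℕ) (T_R : ℝ) :
    P.bathVecR N T_R ∈ (hP.reversedDrift N).noise := hP.bathVec_mem_reversedDrift_noise N _ _

end IsConfining

/-! ### The reversed transition kernels -/

/-- **The transition kernels `P̂_t` of the time-reversed Langevin equation**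
`dz = -Y(z) dt + v_L dB^L + v_R dB^R` (same bath noise). [folklore] -/
def langevinRevKernel (N : ℕ) (T_L T_R : ℝ) (t : ℝ≥0) : Kernel (PhaseSpace N) (PhaseSpace N) :=
  sdeKernel (fun y => -P.drift N y) (P.bathVecL N T_L) (P.bathVecR N T_R) t

namespace IsConfining

variable {P} (hP : P.IsConfining) (N : ℕ) (T_L T_R : ℝ)
include hP

/-- The reversed kernels are Markov kernels. [folklore] -/
theorem isMarkovKernel_langevinRevKernel (t : ℝ≥0) :
    IsMarkovKernel (P.langevinRevKernel N T_L T_R t) :=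
  (hP.reversedDrift N).toConfinedDrift.isMarkovKernel_sdeKernel
    (hP.bathVecL_mem_reversedDrift_noise N T_L) (hP.bathVecR_mem_reversedDrift_noise N T_R) t

/-- **The reversed kernels are Feller**: `y ↦ ∫ g dP̂_t(y, ·)` is continuous for bounded continuous
`g`. [folklore] -/
theorem continuous_integral_langevinRevKernel (t : ℝ≥0) {g : PhaseSpace N → ℝ} (hg : Continuous g)
    {C : ℝ} (hC : ∀ y, ‖g y‖ ≤ C) :
    Continuous fun y => ∫ x, g x ∂(P.langevinRevKernel N T_L T_R t y) :=
  (hP.reversedDrift N).toConfinedDrift.continuous_integral_sdeKernel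
    (hP.bathVecL_mem_reversedDrift_noise N T_L) (hP.bathVecR_mem_reversedDrift_noise N T_R) t hg hC

variable {N} (hU : ContDiff ℝ ∞ P.U) (hV : ContDiff ℝ ∞ P.V) (hN : 0 < N)
include hU hV hN

/-- **Duality of the transition kernels of the Langevin chain with respect to Lebesgue measure**,
measure form: `dx P_t(x, dy) = e^{2γt} · swap_*(dy P̂_t(y, dx))` on `Ω × Ω` for `t > 0` (the drift
has divergence `-2γ`; `ConfinedDuality.lean`). [folklore] -/
theorem compProd_langevinKernel_eq {t : ℝ≥0} (ht : 0 < t) :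
    (volume : Measure (PhaseSpace N)) ⊗ₘ P.langevinKernel N T_L T_R t =
      ENNReal.ofReal (Real.exp (2 * P.γ * t)) •
        ((volume : Measure (PhaseSpace N)) ⊗ₘ P.langevinRevKernel N T_L T_R t).map Prod.swap := by
  haveI := isAddHaarMeasure_volume_phaseSpace N
  have h := (hP.confinedDrift N).toConfinedDrift.compProd_sdeKernel_eq_smul_map_swap
    (hP.reversedDrift N).toConfinedDrift
    (hP.bathVecL_mem_noise N T_L) (hP.bathVecR_mem_noise N T_R)
    (hP.bathVecL_mem_reversedDrift_noise N T_L) (hP.bathVecR_mem_reversedDrift_noise N T_R)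
    volume (fun _ => rfl) (P.trace_fderiv_drift hU hV hN) ht
  rw [show -(-(2 * P.γ) * (t : ℝ)) = 2 * P.γ * t by ring] at h
  exact h

/-- Duality, Lebesgue-integral form: `∫ dx ∫ P_t(x,dy) H(x,y) = e^{2γt} ∫ dy ∫ P̂_t(y,dx) H(x,y)`
for measurable `H ≥ 0`, `t > 0`. [folklore] -/
theorem lintegral_langevinKernel_duality {t : ℝ≥0} (ht : 0 < t)
    {H : PhaseSpace N × PhaseSpace N → ℝ≥0∞} (hH : Measurable H) :
    ∫⁻ x, ∫⁻ y, H (x, y) ∂(P.langevinKernel N T_L T_R t x) =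
      ENNReal.ofReal (Real.exp (2 * P.γ * t)) *
        ∫⁻ y, ∫⁻ x, H (x, y) ∂(P.langevinRevKernel N T_L T_R t y) := by
  haveI := isAddHaarMeasure_volume_phaseSpace N
  have h := (hP.confinedDrift N).toConfinedDrift.lintegral_sdeKernel_duality
    (hP.reversedDrift N).toConfinedDrift
    (hP.bathVecL_mem_noise N T_L) (hP.bathVecR_mem_noise N T_R)
    (hP.bathVecL_mem_reversedDrift_noise N T_L) (hP.bathVecR_mem_reversedDrift_noise N T_R)
    volume (fun _ => rfl) (P.trace_fderiv_drift hU hV hN) ht hH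
  rw [show -(-(2 * P.γ) * (t : ℝ)) = 2 * P.γ * t by ring] at h
  exact h

/-- Duality, Bochner form: for `H` integrable against `dx P_t(x, dy)`, the swapped function is
integrable against `dy P̂_t(y, dx)` and `∫ dx ∫ P_t(x,dy) H = e^{2γt} ∫ dy ∫ P̂_t(y,dx) H`.
[folklore] -/
theorem integral_langevinKernel_duality {t : ℝ≥0} (ht : 0 < t)
    {H : PhaseSpace N × PhaseSpace N → ℝ}
    (hH : Integrable H ((volume : Measure (PhaseSpace N)) ⊗ₘ P.langevinKernel N T_L T_R t)) :
    Integrable (fun p : PhaseSpace N × PhaseSpace N => H p.swap)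
        ((volume : Measure (PhaseSpace N)) ⊗ₘ P.langevinRevKernel N T_L T_R t) ∧
      ∫ x, ∫ y, H (x, y) ∂(P.langevinKernel N T_L T_R t x) =
        Real.exp (2 * P.γ * t) * ∫ y, ∫ x, H (x, y) ∂(P.langevinRevKernel N T_L T_R t y) := by
  haveI := isAddHaarMeasure_volume_phaseSpace N
  have h := (hP.confinedDrift N).toConfinedDrift.integral_sdeKernel_duality
    (hP.reversedDrift N).toConfinedDrift
    (hP.bathVecL_mem_noise N T_L) (hP.bathVecR_mem_noise N T_R)
    (hP.bathVecL_mem_reversedDrift_noise N T_L) (hP.bathVecR_mem_reversedDrift_noise N T_R)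
    volume (fun _ => rfl) (P.trace_fderiv_drift hU hV hN) ht hH
  rw [show -(-(2 * P.γ) * (t : ℝ)) = 2 * P.γ * t by ring] at h
  exact h

/-- **Lebesgue measure is an eigenmeasure of the reversed kernels**: `∫ P̂_t(y, A) dy = e^{-2γt}|A|`.
[folklore] -/
theorem lintegral_langevinRevKernel_apply {t : ℝ≥0} (ht : 0 < t) {A : Set (PhaseSpace N)}
    (hA : MeasurableSet A) :
    ∫⁻ y, P.langevinRevKernel N T_L T_R t y A =
      ENNReal.ofReal (Real.exp (-(2 * P.γ * t))) * volume A := by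
  haveI := isAddHaarMeasure_volume_phaseSpace N
  have h := (hP.confinedDrift N).toConfinedDrift.lintegral_sdeKernel_rev_apply
    (hP.reversedDrift N).toConfinedDrift
    (hP.bathVecL_mem_noise N T_L) (hP.bathVecR_mem_noise N T_R)
    (hP.bathVecL_mem_reversedDrift_noise N T_L) (hP.bathVecR_mem_reversedDrift_noise N T_R)
    volume (fun _ => rfl) (P.trace_fderiv_drift hU hV hN) ht hA
  rw [show -(2 * P.γ) * (t : ℝ) = -(2 * P.γ * t) by ring] at h
  exact h

/-- **The Kolmogorov backward equation for the law `dt dx P_t(x, dy)` of the Langevin chain**: for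
every test function `Θ ∈ C_c^∞(ℝ × Ω × Ω)` supported in `(0, ∞) × Ω × Ω`,
`∫₀^∞ ∫ dx ∫ P_t(x, dy) (∂_tΘ + L̂₁Θ + 2γ Θ)(t, x, y) dt = 0`, where `L̂₁` is the generator of the
reversed equation acting on the first (backward) variable `x`, so that `L̂₁ + 2γ = Lᵀ₁` is the
formal transpose of the generator `L` (3.2). [cite: CuneoEckmannHairerReyBellet2018, §3.1] -/
theorem langevin_backwardEquation {Θ : ℝ × (PhaseSpace N × PhaseSpace N) → ℝ} (hΘ : ContDiff ℝ ∞ Θ)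
    (hΘc : HasCompactSupport Θ) (hΘ0 : tsupport Θ ⊆ Set.Ioi (0 : ℝ) ×ˢ Set.univ) :
    ∫ t in Set.Ioi (0 : ℝ),
      pairAct (P.drift N) (P.bathVecL N T_L) (P.bathVecR N T_R) volume
        (fun p => fderiv ℝ Θ (t, p) (1, 0) +
          (sdeGeneratorFst (fun y => -P.drift N y) (P.bathVecL N T_L) (P.bathVecR N T_R)
              (fun p' => Θ (t, p')) p + 2 * P.γ * Θ (t, p)))
        t.toNNReal = 0 := by
  haveI := isAddHaarMeasure_volume_phaseSpace N
  have h := (hP.confinedDrift N).toConfinedDrift.backwardEquation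
    (hP.bathVecL_mem_noise N T_L) (hP.bathVecR_mem_noise N T_R) volume
    (hP.reversedDrift N) (hP.bathVecL_mem_reversedDrift_noise N T_L)
    (hP.bathVecR_mem_reversedDrift_noise N T_R)
    (fun _ => rfl) (P.trace_fderiv_drift hU hV hN) hΘ hΘc hΘ0
  have hfun : ∀ t : ℝ, (fun p : PhaseSpace N × PhaseSpace N => fderiv ℝ Θ (t, p) (1, 0) +
      (sdeGeneratorFst (fun y => -P.drift N y) (P.bathVecL N T_L) (P.bathVecR N T_R)
        (fun p' => Θ (t, p')) p - -(2 * P.γ) * Θ (t, p))) =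
      fun p => fderiv ℝ Θ (t, p) (1, 0) +
        (sdeGeneratorFst (fun y => -P.drift N y) (P.bathVecL N T_L) (P.bathVecR N T_R)
          (fun p' => Θ (t, p')) p + 2 * P.γ * Θ (t, p)) := by
    intro t
    funext p
    ring
  simp_rw [hfun] at h
  exact h

end IsConfining

end OscillatorChain

end Literature.MathematicalPhysics.KineticTheory.HeatConduction
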